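import Literature.Topology.FourManifolds.HCobordismCancellationFrameSmooth
import HarnessLib

/-!
# Milnor 1965, proof of Thm. 5.4, Assertion 6, the general case: the two box charts of the
# cobordism at `p₂` in which the deformation of `h` is written

Topic `Literature/Topology/FourManifolds` (fact seat
`provefact-Literature.Topology.FourManifolds.Cobord-288d2994d8`, towards the named fact
`Literature.Topology.FourManifolds.Cobordism.Milnor1965_cancellation_levelDeformation` of
`HCobordismLevelIsotopy.lean`).  Milnor, *Lectures on the h-cobordism theorem* (1965), proof of
Thm. 5.4, Assertion 6 (held copy, PDF pp. 31–32): the deformation of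
`h : f⁻¹(b₁) → f⁻¹(b₂)` is *"specified by giving a suitable isotopy of `h₀⁻¹h`"* near `p₁`.
In the tree that isotopy is the pair of compactly supported ambient isotopies `Ψ` (target,
moving points parallel to `Rᵇ`) and `Φ` (source, preserving `Rᵃ × 0`) of the level coordinates
`Rᵃ × Rᵇ` with `Ψ₁ ∘ (h₀⁻¹h) ∘ Φ₁ = id` near `0` (`MilnorLocalIsotopyPair.lean`).  They are
transported into the cobordism `W` through two charts of `W` at `p₂` valued in
`ℝ × (Rᵃ × Rᵇ)` — first coordinate `f - b₂`, so that the level `f⁻¹(b₂)` is the slice `0` —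
which this file constructs from the frame `D` of `HCobordismCancellationFrame.lean`:

* `CancellationFrame.sliceChart D` (`Ξ = S₂ ∘ G₂`): `Ξ y = (f y - b₂, ψ₂ y)` — the upper chart
  `g₂⁻¹` followed by the level chart of the model at `t₂e₀`;
* `CancellationFrame.chartA D` (`κ_A = (id × Λcinv) ∘ Ξ`): the coordinates in which
  `h₀ ∘ lift₁` reads as the identity and `h ∘ lift₁` as `Φ = Λcinv ∘ Hc` (`h₀⁻¹h` in
  coordinates): `κ_A (h (lift₁ w)) = (0, Φ w)`, `κ_A (h₀ (lift₁ w)) = (0, w)`;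
* `CancellationFrame.chartB D` (`κ_B = (id × Hcinv) ∘ Ξ`): the coordinates in which `h ∘ lift₁`
  reads as the identity: `κ_B (h (lift₁ w)) = (0, w)`;

together with their smoothness in both directions (interior charts of the manifold with
boundary `W`), the formula for the first coordinate (`f - b₂`), and `κ_A p₂ = κ_B p₂ = (0, 0)`.
Everything here is proved; no named facts.

## References

* J. Milnor, *Lectures on the h-cobordism theorem*, notes by L. Siebenmann and J. Sondow,
  Princeton Mathematical Notes (1965): proof of Thm. 5.4, Assertion 6 (PDF pp. 30–32).  Held:
  `lit read book:milnornd-lectures-h-cobordism-theorem`. [MilnorHCobordism1965]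
-/

open scoped Manifold ContDiff Topology NNReal
open Set Function Filter

noncomputable section

namespace Literature.Topology.FourManifolds

open Flow

universe u

/-! ### A partial homeomorphism from an inverse pair on open sets -/

section InvPair

variable {P : Type*} [TopologicalSpace P]

/-- **A partial homeomorphism of `P` from a pair of maps inverse to each other on open sets**:
`g` on `O = O₁ ∩ g⁻¹(O₂)` and `g'` on `O' = O₂ ∩ g'⁻¹(O₁)`, where `g' (g y) = y` on `O₁`,
`g (g' y) = y` on `O₂`, and `g`, `g'` are continuous on `O₁`, `O₂`. [folklore] -/
def OpenPartialHomeomorph.ofInvPair (g g' : P → P) (O₁ O₂ : Set P) (hO₁ : IsOpen O₁)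
    (hO₂ : IsOpen O₂) (hg : ContinuousOn g O₁) (hg' : ContinuousOn g' O₂)
    (hleft : ∀ y ∈ O₁, g y ∈ O₂ → g' (g y) = y) (hright : ∀ y ∈ O₂, g' y ∈ O₁ → g (g' y) = y) :
    OpenPartialHomeomorph P P where
  toFun := g
  invFun := g'
  source := O₁ ∩ g ⁻¹' O₂
  target := O₂ ∩ g' ⁻¹' O₁
  map_source' y hy := ⟨hy.2, by rw [mem_preimage, hleft y hy.1 hy.2]; exact hy.1⟩
  map_target' y hy := ⟨hy.2, by rw [mem_preimage, hright y hy.1 hy.2]; exact hy.1⟩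
  left_inv' y hy := hleft y hy.1 hy.2
  right_inv' y hy := hright y hy.1 hy.2
  open_source := hg.isOpen_inter_preimage hO₁ hO₂
  open_target := hg'.isOpen_inter_preimage hO₂ hO₁
  continuousOn_toFun := hg.mono inter_subset_left
  continuousOn_invFun := hg'.mono inter_subset_left

/-- The map of `ofInvPair`. [folklore] -/
@[simp] theorem OpenPartialHomeomorph.ofInvPair_apply (g g' : P → P) (O₁ O₂ : Set P) (hO₁ : IsOpen O₁)
    (hO₂ : IsOpen O₂) (hg : ContinuousOn g O₁) (hg' : ContinuousOn g' O₂)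
    (hleft : ∀ y ∈ O₁, g y ∈ O₂ → g' (g y) = y) (hright : ∀ y ∈ O₂, g' y ∈ O₁ → g (g' y) = y)
    (y : P) : OpenPartialHomeomorph.ofInvPair g g' O₁ O₂ hO₁ hO₂ hg hg' hleft hright y = g y := rfl

/-- The inverse of `ofInvPair`. [folklore] -/
@[simp] theorem OpenPartialHomeomorph.ofInvPair_symm_apply (g g' : P → P) (O₁ O₂ : Set P)
    (hO₁ : IsOpen O₁) (hO₂ : IsOpen O₂) (hg : ContinuousOn g O₁) (hg' : ContinuousOn g' O₂)
    (hleft : ∀ y ∈ O₁, g y ∈ O₂ → g' (g y) = y) (hright : ∀ y ∈ O₂, g' y ∈ O₁ → g (g' y) = y)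
    (y : P) :
    (OpenPartialHomeomorph.ofInvPair g g' O₁ O₂ hO₁ hO₂ hg hg' hleft hright).symm y = g' y := rfl

/-- The source of `ofInvPair`. [folklore] -/
theorem OpenPartialHomeomorph.ofInvPair_source (g g' : P → P) (O₁ O₂ : Set P) (hO₁ : IsOpen O₁)
    (hO₂ : IsOpen O₂) (hg : ContinuousOn g O₁) (hg' : ContinuousOn g' O₂)
    (hleft : ∀ y ∈ O₁, g y ∈ O₂ → g' (g y) = y) (hright : ∀ y ∈ O₂, g' y ∈ O₁ → g (g' y) = y) :
    (OpenPartialHomeomorph.ofInvPair g g' O₁ O₂ hO₁ hO₂ hg hg' hleft hright).source = O₁ ∩ g ⁻¹' O₂ :=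
  rfl

/-- The target of `ofInvPair`. [folklore] -/
theorem OpenPartialHomeomorph.ofInvPair_target (g g' : P → P) (O₁ O₂ : Set P) (hO₁ : IsOpen O₁)
    (hO₂ : IsOpen O₂) (hg : ContinuousOn g O₁) (hg' : ContinuousOn g' O₂)
    (hleft : ∀ y ∈ O₁, g y ∈ O₂ → g' (g y) = y) (hright : ∀ y ∈ O₂, g' y ∈ O₁ → g (g' y) = y) :
    (OpenPartialHomeomorph.ofInvPair g g' O₁ O₂ hO₁ hO₂ hg hg' hleft hright).target = O₂ ∩ g' ⁻¹' O₁ :=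
  rfl

end InvPair

/-- Local notation: the model Euclidean space. -/
local notation "𝔼 " n:arg => EuclideanSpace ℝ (Fin n)

variable {n : ℕ} {M N : Type u} [TopologicalSpace M] [ChartedSpace (𝔼 n) M]
  [TopologicalSpace N] [ChartedSpace (𝔼 n) N]

namespace Cobordism

namespace CancellationFrame

variable {c : Cobordism n M N} {f : c.W → ℝ}
  {ξ : Cₛ^∞⟮𝓡∂ (n + 1); 𝔼 (n + 1), (TangentSpace (𝓡∂ (n + 1)) : c.W → Type)⟯}
  {p p' : c.W} {k : ℕ} {v : ℝ → ℝ} {b₁ b₂ : ℝ}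
  (D : CancellationFrame c f ξ p p' k v b₁ b₂)

/-! ### The slice chart `Ξ = S₂ ∘ G₂` -/

/-- **The slice chart at `p₂`**: `Ξ = S₂ ∘ G₂ : W ⊇ U → ℝ × (Rᵃ × Rᵇ)`, `Ξ y = (f y - b₂, ψ₂ y)`.
[cite: MilnorHCobordism1965, proof of Thm. 5.4, Assertion 6 (PDF p. 31)] -/
def sliceChart : OpenPartialHomeomorph c.W (ℝ × (𝔼 (n - k) × 𝔼 k)) := D.G₂.trans D.S₂

/-- The source of the slice chart. [folklore] -/
theorem sliceChart_source : D.sliceChart.source = D.G₂.source ∩ D.G₂ ⁻¹' D.S₂.source :=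
  OpenPartialHomeomorph.trans_source _ _

/-- The target of the slice chart. [folklore] -/
theorem sliceChart_target : D.sliceChart.target = D.S₂.target ∩ D.S₂.symm ⁻¹' D.G₂.target :=
  OpenPartialHomeomorph.trans_target _ _

/-- The slice chart as a function. [folklore] -/
theorem sliceChart_apply (y : c.W) : D.sliceChart y = D.S₂ (D.G₂ y) := rfl

/-- The inverse slice chart as a function. [folklore] -/
theorem sliceChart_symm_apply (q : ℝ × (𝔼 (n - k) × 𝔼 k)) :
    D.sliceChart.symm q = D.G₂.symm (D.S₂.symm q) := rfl

/-- On the domain of the upper chart the two Morse functions of the model agree at `G₂ y` when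
`(G₂ y)₀ ∈ (0, 1)`, so `f y = F(G₂ y)` for the Lipschitz-modified profile as well. [cite: MilnorHCobordism1965, proof of Thm. 5.4, Assertion 6 (PDF p. 30)] -/
theorem apply_eq_lipschitz {y : c.W} (hy : y ∈ D.G₂.source) (hyS : D.G₂ y ∈ D.S₂.source) :
    f y = milnorCancellationMorse k (lipschitzProfile v) (f p) (D.G₂ y) := by
  rw [milnorCancellationMorse_lipschitzProfile_of_mem_Ioo k (f p) (D.source₂ hyS).2]
  exact D.upper.apply_eq y hy

/-- **The slice chart: `Ξ y = (f y - b₂, ψ₂ y)`** on its source. [cite: MilnorHCobordism1965, proof of Thm. 5.4, Assertion 6 (PDF p. 31)] -/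
theorem sliceChart_apply_of_mem {y : c.W} (hy : y ∈ D.sliceChart.source) :
    D.sliceChart y = (f y - b₂, D.ψ₂ y) := by
  rw [D.sliceChart_source] at hy
  rw [D.sliceChart_apply, D.level₂.apply, ← D.apply_eq_lipschitz hy.1 hy.2]
  rfl

/-- `p₂` lies in the source of the slice chart. [folklore] -/
theorem p₂_mem_sliceChart_source : D.p₂ ∈ D.sliceChart.source := by
  rw [D.sliceChart_source]
  refine ⟨D.p₂_mem, ?_⟩
  rw [mem_preimage, D.G₂_p₂]
  exact D.mem₂

/-- `Ξ p₂ = (0, 0)`. [folklore] -/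
theorem sliceChart_p₂ : D.sliceChart D.p₂ = (0, 0) := by
  rw [D.sliceChart_apply_of_mem D.p₂_mem_sliceChart_source, D.f_p₂, sub_self, D.ψ₂_p₂]

/-- The slice chart is smooth on its source. [folklore] -/
theorem contMDiffOn_sliceChart :
    ContMDiffOn (𝓡∂ (n + 1)) 𝓘(ℝ, ℝ × (𝔼 (n - k) × 𝔼 k)) ∞ D.sliceChart D.sliceChart.source := by
  rw [D.sliceChart_source]
  exact D.level₂.contDiffOn.contMDiffOn.comp (D.upper.contMDiffOn.mono inter_subset_left)
    fun y hy => hy.2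

/-- The inverse slice chart is smooth on its target. [folklore] -/
theorem contMDiffOn_sliceChart_symm :
    ContMDiffOn 𝓘(ℝ, ℝ × (𝔼 (n - k) × 𝔼 k)) (𝓡∂ (n + 1)) ∞ D.sliceChart.symm D.sliceChart.target := by
  rw [D.sliceChart_target]
  exact D.upper.contMDiffOn_symm.comp (D.level₂.contDiffOn_symm.contMDiffOn.mono inter_subset_left)
    fun q hq => hq.2

/-- The first coordinate of the slice chart is `f - b₂`: `f (Ξ⁻¹ q) = b₂ + q.1` on the target. [folklore] -/
theorem apply_sliceChart_symm {q : ℝ × (𝔼 (n - k) × 𝔼 k)} (hq : q ∈ D.sliceChart.target) :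
    f (D.sliceChart.symm q) = b₂ + q.1 := by
  have h1 : D.sliceChart (D.sliceChart.symm q) = q := D.sliceChart.right_inv hq
  rw [D.sliceChart_apply_of_mem (D.sliceChart.map_target hq)] at h1
  have := congrArg Prod.fst h1
  simp only at this
  linarith

/-! ### The coordinate changes `id × Λcinv` and `id × Hcinv` -/

/-- The open set on which `Λcinv` is used: `domΛ' ∩ Λcinv⁻¹(domΛ)`. [folklore] -/
def domA : Set (𝔼 (n - k) × 𝔼 k) := D.domΛ' ∩ D.Λcinv ⁻¹' D.domΛ

/-- The open set on which `Hcinv` is used: `domH' ∩ Hcinv⁻¹(domH)`. [folklore] -/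
def domB : Set (𝔼 (n - k) × 𝔼 k) := D.domH' ∩ D.Hcinv ⁻¹' D.domH

/-- `Λcinv` is continuous on `domΛ'`. [folklore] -/
theorem continuousOn_Λcinv : ContinuousOn D.Λcinv D.domΛ' :=
  fun _ hy => (D.contDiffAt_Λcinv hy).continuousAt.continuousWithinAt

/-- `Λc` is continuous on `domΛ`. [folklore] -/
theorem continuousOn_Λc : ContinuousOn D.Λc D.domΛ :=
  fun _ hy => (D.contDiffAt_Λc hy).continuousAt.continuousWithinAt

/-- `Hcinv` is continuous on `domH'`. [folklore] -/
theorem continuousOn_Hcinv : ContinuousOn D.Hcinv D.domH' :=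
  fun _ hy => (D.contDiffAt_Hcinv hy).continuousAt.continuousWithinAt

/-- `Hc` is continuous on `domH`. [folklore] -/
theorem continuousOn_Hc : ContinuousOn D.Hc D.domH :=
  fun _ hy => (D.contDiffAt_Hc hy).continuousAt.continuousWithinAt

/-- The coordinate change `Λcinv` as a partial homeomorphism of `Rᵃ × Rᵇ` (inverse `Λc`). [cite: MilnorHCobordism1965, proof of Thm. 5.4, Assertion 6 (PDF p. 31)] -/
def eA : OpenPartialHomeomorph (𝔼 (n - k) × 𝔼 k) (𝔼 (n - k) × 𝔼 k) :=
  OpenPartialHomeomorph.ofInvPair D.Λcinv D.Λc D.domΛ' D.domΛ D.isOpen_domΛ' D.isOpen_domΛ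
    D.continuousOn_Λcinv D.continuousOn_Λc (fun _ hy _ => D.Λc_Λcinv hy) fun _ hy _ => D.Λcinv_Λc hy

/-- The coordinate change `Hcinv` as a partial homeomorphism of `Rᵃ × Rᵇ` (inverse `Hc`). [cite: MilnorHCobordism1965, proof of Thm. 5.4, Assertion 6 (PDF p. 31)] -/
def eB : OpenPartialHomeomorph (𝔼 (n - k) × 𝔼 k) (𝔼 (n - k) × 𝔼 k) :=
  OpenPartialHomeomorph.ofInvPair D.Hcinv D.Hc D.domH' D.domH D.isOpen_domH' D.isOpen_domH
    D.continuousOn_Hcinv D.continuousOn_Hc (fun _ hy _ => D.Hc_Hcinv hy) fun _ hy _ => D.Hcinv_Hc hy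

/-- `eA` as a function. [folklore] -/
@[simp] theorem eA_apply (y : 𝔼 (n - k) × 𝔼 k) : D.eA y = D.Λcinv y := rfl

/-- `eA⁻¹` as a function. [folklore] -/
@[simp] theorem eA_symm_apply (y : 𝔼 (n - k) × 𝔼 k) : D.eA.symm y = D.Λc y := rfl

/-- `eB` as a function. [folklore] -/
@[simp] theorem eB_apply (y : 𝔼 (n - k) × 𝔼 k) : D.eB y = D.Hcinv y := rfl

/-- `eB⁻¹` as a function. [folklore] -/
@[simp] theorem eB_symm_apply (y : 𝔼 (n - k) × 𝔼 k) : D.eB.symm y = D.Hc y := rfl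

/-- The source of `eA`. [folklore] -/
theorem eA_source : D.eA.source = D.domA := rfl

/-- The source of `eB`. [folklore] -/
theorem eB_source : D.eB.source = D.domB := rfl

/-- `0 ∈ domA`. [folklore] -/
theorem zero_mem_domA : (0 : 𝔼 (n - k) × 𝔼 k) ∈ D.domA :=
  ⟨D.zero_mem_domΛ', by rw [mem_preimage, D.Λcinv_zero]; exact D.zero_mem_domΛ⟩

/-- `0 ∈ domB`. [folklore] -/
theorem zero_mem_domB : (0 : 𝔼 (n - k) × 𝔼 k) ∈ D.domB :=
  ⟨D.zero_mem_domH', by rw [mem_preimage, D.Hcinv_zero]; exact D.zero_mem_domH⟩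

/-- `domA` is open. [folklore] -/
theorem isOpen_domA : IsOpen D.domA := D.eA.open_source

/-- `domB` is open. [folklore] -/
theorem isOpen_domB : IsOpen D.domB := D.eB.open_source

/-- `eA` is smooth on its source. [folklore] -/
theorem contDiffOn_eA : ContDiffOn ℝ ∞ D.eA D.eA.source :=
  fun _ hy => (D.contDiffAt_Λcinv hy.1).contDiffWithinAt

/-- `eA⁻¹` is smooth on its target. [folklore] -/
theorem contDiffOn_eA_symm : ContDiffOn ℝ ∞ D.eA.symm D.eA.target :=
  fun _ hy => (D.contDiffAt_Λc hy.1).contDiffWithinAt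

/-- `eB` is smooth on its source. [folklore] -/
theorem contDiffOn_eB : ContDiffOn ℝ ∞ D.eB D.eB.source :=
  fun _ hy => (D.contDiffAt_Hcinv hy.1).contDiffWithinAt

/-- `eB⁻¹` is smooth on its target. [folklore] -/
theorem contDiffOn_eB_symm : ContDiffOn ℝ ∞ D.eB.symm D.eB.target :=
  fun _ hy => (D.contDiffAt_Hc hy.1).contDiffWithinAt

/-! ### The box charts `κ_A`, `κ_B` -/

/-- **The box chart `κ_A = (id × Λcinv) ∘ Ξ` of `W` at `p₂`**, valued in `ℝ × (Rᵃ × Rᵇ)`: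
`κ_A y = (f y - b₂, Λcinv (ψ₂ y))`. [cite: MilnorHCobordism1965, proof of Thm. 5.4, Assertion 6 (PDF pp. 31–32)] -/
def chartA : OpenPartialHomeomorph c.W (ℝ × (𝔼 (n - k) × 𝔼 k)) :=
  D.sliceChart.trans ((OpenPartialHomeomorph.refl ℝ).prod D.eA)

/-- **The box chart `κ_B = (id × Hcinv) ∘ Ξ` of `W` at `p₂`**: `κ_B y = (f y - b₂, Hcinv (ψ₂ y))`. [cite: MilnorHCobordism1965, proof of Thm. 5.4, Assertion 6 (PDF pp. 31–32)] -/
def chartB : OpenPartialHomeomorph c.W (ℝ × (𝔼 (n - k) × 𝔼 k)) :=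
  D.sliceChart.trans ((OpenPartialHomeomorph.refl ℝ).prod D.eB)

/-- `κ_A` as a function. [folklore] -/
theorem chartA_apply (y : c.W) : D.chartA y = ((D.sliceChart y).1, D.Λcinv (D.sliceChart y).2) := rfl

/-- `κ_B` as a function. [folklore] -/
theorem chartB_apply (y : c.W) : D.chartB y = ((D.sliceChart y).1, D.Hcinv (D.sliceChart y).2) := rfl

/-- `κ_A⁻¹` as a function. [folklore] -/
theorem chartA_symm_apply (q : ℝ × (𝔼 (n - k) × 𝔼 k)) :
    D.chartA.symm q = D.sliceChart.symm (q.1, D.Λc q.2) := rfl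

/-- `κ_B⁻¹` as a function. [folklore] -/
theorem chartB_symm_apply (q : ℝ × (𝔼 (n - k) × 𝔼 k)) :
    D.chartB.symm q = D.sliceChart.symm (q.1, D.Hc q.2) := rfl

/-- The source of `κ_A`. [folklore] -/
theorem mem_chartA_source_iff {y : c.W} :
    y ∈ D.chartA.source ↔ y ∈ D.sliceChart.source ∧ (D.sliceChart y).2 ∈ D.domA := by
  rw [chartA, OpenPartialHomeomorph.trans_source, mem_inter_iff, mem_preimage,
    OpenPartialHomeomorph.prod_source, mem_prod, OpenPartialHomeomorph.refl_source]
  simp only [mem_univ, true_and]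
  rfl

/-- The source of `κ_B`. [folklore] -/
theorem mem_chartB_source_iff {y : c.W} :
    y ∈ D.chartB.source ↔ y ∈ D.sliceChart.source ∧ (D.sliceChart y).2 ∈ D.domB := by
  rw [chartB, OpenPartialHomeomorph.trans_source, mem_inter_iff, mem_preimage,
    OpenPartialHomeomorph.prod_source, mem_prod, OpenPartialHomeomorph.refl_source]
  simp only [mem_univ, true_and]
  rfl

/-- **`κ_A y = (f y - b₂, Λcinv (ψ₂ y))`** on its source. [cite: MilnorHCobordism1965, proof of Thm. 5.4, Assertion 6 (PDF pp. 31–32)] -/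
theorem chartA_apply_of_mem {y : c.W} (hy : y ∈ D.chartA.source) :
    D.chartA y = (f y - b₂, D.Λcinv (D.ψ₂ y)) := by
  rw [D.chartA_apply, D.sliceChart_apply_of_mem ((D.mem_chartA_source_iff).1 hy).1]

/-- **`κ_B y = (f y - b₂, Hcinv (ψ₂ y))`** on its source. [cite: MilnorHCobordism1965, proof of Thm. 5.4, Assertion 6 (PDF pp. 31–32)] -/
theorem chartB_apply_of_mem {y : c.W} (hy : y ∈ D.chartB.source) :
    D.chartB y = (f y - b₂, D.Hcinv (D.ψ₂ y)) := by
  rw [D.chartB_apply, D.sliceChart_apply_of_mem ((D.mem_chartB_source_iff).1 hy).1]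

/-- `p₂` lies in the source of `κ_A`. [folklore] -/
theorem p₂_mem_chartA_source : D.p₂ ∈ D.chartA.source := by
  rw [D.mem_chartA_source_iff, D.sliceChart_p₂]
  exact ⟨D.p₂_mem_sliceChart_source, D.zero_mem_domA⟩

/-- `p₂` lies in the source of `κ_B`. [folklore] -/
theorem p₂_mem_chartB_source : D.p₂ ∈ D.chartB.source := by
  rw [D.mem_chartB_source_iff, D.sliceChart_p₂]
  exact ⟨D.p₂_mem_sliceChart_source, D.zero_mem_domB⟩

/-- `κ_A p₂ = (0, 0)`. [folklore] -/
theorem chartA_p₂ : D.chartA D.p₂ = (0, 0) := by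
  rw [D.chartA_apply, D.sliceChart_p₂]
  simp [D.Λcinv_zero]

/-- `κ_B p₂ = (0, 0)`. [folklore] -/
theorem chartB_p₂ : D.chartB D.p₂ = (0, 0) := by
  rw [D.chartB_apply, D.sliceChart_p₂]
  simp [D.Hcinv_zero]

/-- The coordinate change `id × eA` is smooth on its source. [folklore] -/
theorem contMDiffOn_prod_eA :
    ContMDiffOn 𝓘(ℝ, ℝ × (𝔼 (n - k) × 𝔼 k)) 𝓘(ℝ, ℝ × (𝔼 (n - k) × 𝔼 k)) ∞
      ((OpenPartialHomeomorph.refl ℝ).prod D.eA) ((OpenPartialHomeomorph.refl ℝ).prod D.eA).source := by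
  rw [OpenPartialHomeomorph.prod_source, OpenPartialHomeomorph.refl_source]
  exact (contDiffOn_id.prodMap D.contDiffOn_eA).contMDiffOn

/-- The inverse coordinate change `id × eA⁻¹` is smooth on its target. [folklore] -/
theorem contMDiffOn_prod_eA_symm :
    ContMDiffOn 𝓘(ℝ, ℝ × (𝔼 (n - k) × 𝔼 k)) 𝓘(ℝ, ℝ × (𝔼 (n - k) × 𝔼 k)) ∞
      ((OpenPartialHomeomorph.refl ℝ).prod D.eA).symm ((OpenPartialHomeomorph.refl ℝ).prod D.eA).target := by
  rw [OpenPartialHomeomorph.prod_target, OpenPartialHomeomorph.refl_target,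
    OpenPartialHomeomorph.prod_symm, OpenPartialHomeomorph.refl_symm]
  exact (contDiffOn_id.prodMap D.contDiffOn_eA_symm).contMDiffOn

/-- The coordinate change `id × eB` is smooth on its source. [folklore] -/
theorem contMDiffOn_prod_eB :
    ContMDiffOn 𝓘(ℝ, ℝ × (𝔼 (n - k) × 𝔼 k)) 𝓘(ℝ, ℝ × (𝔼 (n - k) × 𝔼 k)) ∞
      ((OpenPartialHomeomorph.refl ℝ).prod D.eB) ((OpenPartialHomeomorph.refl ℝ).prod D.eB).source := by
  rw [OpenPartialHomeomorph.prod_source, OpenPartialHomeomorph.refl_source]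
  exact (contDiffOn_id.prodMap D.contDiffOn_eB).contMDiffOn

/-- The inverse coordinate change `id × eB⁻¹` is smooth on its target. [folklore] -/
theorem contMDiffOn_prod_eB_symm :
    ContMDiffOn 𝓘(ℝ, ℝ × (𝔼 (n - k) × 𝔼 k)) 𝓘(ℝ, ℝ × (𝔼 (n - k) × 𝔼 k)) ∞
      ((OpenPartialHomeomorph.refl ℝ).prod D.eB).symm ((OpenPartialHomeomorph.refl ℝ).prod D.eB).target := by
  rw [OpenPartialHomeomorph.prod_target, OpenPartialHomeomorph.refl_target,
    OpenPartialHomeomorph.prod_symm, OpenPartialHomeomorph.refl_symm]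
  exact (contDiffOn_id.prodMap D.contDiffOn_eB_symm).contMDiffOn

/-- **`κ_A` is smooth on its source.** [folklore] -/
theorem contMDiffOn_chartA :
    ContMDiffOn (𝓡∂ (n + 1)) 𝓘(ℝ, ℝ × (𝔼 (n - k) × 𝔼 k)) ∞ D.chartA D.chartA.source := by
  rw [chartA, OpenPartialHomeomorph.trans_source]
  exact D.contMDiffOn_prod_eA.comp (D.contMDiffOn_sliceChart.mono inter_subset_left) fun y hy => hy.2

/-- **`κ_A⁻¹` is smooth on its target.** [folklore] -/
theorem contMDiffOn_chartA_symm :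
    ContMDiffOn 𝓘(ℝ, ℝ × (𝔼 (n - k) × 𝔼 k)) (𝓡∂ (n + 1)) ∞ D.chartA.symm D.chartA.target := by
  rw [chartA, OpenPartialHomeomorph.trans_target]
  exact D.contMDiffOn_sliceChart_symm.comp (D.contMDiffOn_prod_eA_symm.mono inter_subset_left)
    fun q hq => hq.2

/-- **`κ_B` is smooth on its source.** [folklore] -/
theorem contMDiffOn_chartB :
    ContMDiffOn (𝓡∂ (n + 1)) 𝓘(ℝ, ℝ × (𝔼 (n - k) × 𝔼 k)) ∞ D.chartB D.chartB.source := by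
  rw [chartB, OpenPartialHomeomorph.trans_source]
  exact D.contMDiffOn_prod_eB.comp (D.contMDiffOn_sliceChart.mono inter_subset_left) fun y hy => hy.2

/-- **`κ_B⁻¹` is smooth on its target.** [folklore] -/
theorem contMDiffOn_chartB_symm :
    ContMDiffOn 𝓘(ℝ, ℝ × (𝔼 (n - k) × 𝔼 k)) (𝓡∂ (n + 1)) ∞ D.chartB.symm D.chartB.target := by
  rw [chartB, OpenPartialHomeomorph.trans_target]
  exact D.contMDiffOn_sliceChart_symm.comp (D.contMDiffOn_prod_eB_symm.mono inter_subset_left)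
    fun q hq => hq.2

/-- **The first coordinate of `κ_A` is `f - b₂`**: `f (κ_A⁻¹ q) = b₂ + q.1` on the target. [cite: MilnorHCobordism1965, proof of Thm. 5.4, Assertion 6 (PDF pp. 31–32)] -/
theorem apply_chartA_symm {q : ℝ × (𝔼 (n - k) × 𝔼 k)} (hq : q ∈ D.chartA.target) :
    f (D.chartA.symm q) = b₂ + q.1 := by
  have hq' : ((OpenPartialHomeomorph.refl ℝ).prod D.eA).symm q ∈ D.sliceChart.target := by
    rw [chartA, OpenPartialHomeomorph.trans_target] at hq
    exact hq.2
  rw [chartA, OpenPartialHomeomorph.coe_trans_symm, comp_apply, D.apply_sliceChart_symm hq']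
  rfl

/-- **The first coordinate of `κ_B` is `f - b₂`**: `f (κ_B⁻¹ q) = b₂ + q.1` on the target. [cite: MilnorHCobordism1965, proof of Thm. 5.4, Assertion 6 (PDF pp. 31–32)] -/
theorem apply_chartB_symm {q : ℝ × (𝔼 (n - k) × 𝔼 k)} (hq : q ∈ D.chartB.target) :
    f (D.chartB.symm q) = b₂ + q.1 := by
  have hq' : ((OpenPartialHomeomorph.refl ℝ).prod D.eB).symm q ∈ D.sliceChart.target := by
    rw [chartB, OpenPartialHomeomorph.trans_target] at hq
    exact hq.2
  rw [chartB, OpenPartialHomeomorph.coe_trans_symm, comp_apply, D.apply_sliceChart_symm hq']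
  rfl

/-! ### The level diffeomorphisms in the box charts -/

section Formulas

variable {w : 𝔼 (n - k) × 𝔼 k}

/-- **`h ∘ lift₁` in the chart `κ_B` is the slice inclusion**: `κ_B (h (lift₁ w)) = (0, w)` for
`w ∈ domH` with `h (lift₁ w)` in the chart domain. [cite: MilnorHCobordism1965, proof of Thm. 5.4, Assertion 6 (PDF pp. 31–32)] -/
theorem chartB_h_lift₁ (hw : w ∈ D.domH) (hmem : D.h (D.lift₁ w) ∈ D.chartB.source) :
    D.chartB (D.h (D.lift₁ w)) = (0, w) := by
  rw [D.chartB_apply_of_mem hmem, D.f_h (D.f_lift₁_mem hw.1), sub_self]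
  exact Prod.ext rfl (D.Hcinv_Hc hw)

/-- **`h ∘ lift₁` in the chart `κ_A` is `Φ = h₀⁻¹h`**: `κ_A (h (lift₁ w)) = (0, Φ w)`. [cite: MilnorHCobordism1965, proof of Thm. 5.4, Assertion 6 (PDF pp. 31–32)] -/
theorem chartA_h_lift₁ (hw : w ∈ D.dom₁) (hmem : D.h (D.lift₁ w) ∈ D.chartA.source) :
    D.chartA (D.h (D.lift₁ w)) = (0, D.Φ w) := by
  rw [D.chartA_apply_of_mem hmem, D.f_h (D.f_lift₁_mem hw), sub_self]
  rfl

/-- The `g₂`-coordinates of `h₀ (lift₁ w)`: `G₂ (h₀ (lift₁ w)) = Λ (S₁⁻¹(0, w))` for `w ∈ domΛ`. [folklore] -/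
theorem G₂_h₀_lift₁ (hw : w ∈ D.domΛ) : D.G₂ (D.h₀ (D.lift₁ w)) = D.Λ (D.S₁.symm (0, w)) := by
  have hx₂ : D.Λ (D.S₁.symm (0, w)) ∈ D.G₂.target := (D.source₂ hw.2.2).1
  show D.G₂ (D.G₂.symm (D.Λ (D.G₁ (D.lift₁ w)))) = D.Λ (D.S₁.symm (0, w))
  rw [D.G₁_lift₁ hw.1, D.G₂.right_inv hx₂]

/-- `h₀ (lift₁ w)` lies in the domain of `g₂⁻¹`, for `w ∈ domΛ`. [folklore] -/
theorem h₀_lift₁_mem (hw : w ∈ D.domΛ) : D.h₀ (D.lift₁ w) ∈ D.G₂.source := by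
  have hx₂ : D.Λ (D.S₁.symm (0, w)) ∈ D.G₂.target := (D.source₂ hw.2.2).1
  show D.G₂.symm (D.Λ (D.G₁ (D.lift₁ w))) ∈ D.G₂.source
  rw [D.G₁_lift₁ hw.1]
  exact D.G₂.map_target hx₂

/-- `h₀ (lift₁ w)` lies on the level `b₂`, for `w ∈ domΛ`. [cite: MilnorHCobordism1965, proof of Thm. 5.4, Assertion 6 (PDF p. 31)] -/
theorem f_h₀_lift₁ (hw : w ∈ D.domΛ) : f (D.h₀ (D.lift₁ w)) = b₂ := by
  have hS : D.G₂ (D.h₀ (D.lift₁ w)) ∈ D.S₂.source := by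
    rw [D.G₂_h₀_lift₁ hw]
    exact hw.2.2
  rw [D.apply_eq_lipschitz (D.h₀_lift₁_mem hw) hS, D.G₂_h₀_lift₁ hw]
  exact D.apply_Λ hw.2.1

/-- The level coordinates of `h₀ (lift₁ w)` are `Λc w`, for `w ∈ domΛ`. [cite: MilnorHCobordism1965, proof of Thm. 5.4, Assertion 6 (PDF p. 31)] -/
theorem ψ₂_h₀_lift₁ (hw : w ∈ D.domΛ) : D.ψ₂ (D.h₀ (D.lift₁ w)) = D.Λc w := by
  show splitCoords n k D.hk (D.G₂ (D.h₀ (D.lift₁ w))) = D.Λc w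
  rw [D.G₂_h₀_lift₁ hw]
  rfl

/-- `h₀ (lift₁ w)` lies in the source of the slice chart, for `w ∈ domΛ`. [folklore] -/
theorem h₀_lift₁_mem_sliceChart_source (hw : w ∈ D.domΛ) : D.h₀ (D.lift₁ w) ∈ D.sliceChart.source := by
  rw [D.sliceChart_source]
  refine ⟨D.h₀_lift₁_mem hw, ?_⟩
  rw [mem_preimage, D.G₂_h₀_lift₁ hw]
  exact hw.2.2

/-- `h₀ (lift₁ w)` lies in the source of `κ_A`, for `w ∈ domΛ` with `Λc w ∈ domA`. [folklore] -/
theorem h₀_lift₁_mem_chartA_source (hw : w ∈ D.domΛ) (hw' : D.Λc w ∈ D.domA) :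
    D.h₀ (D.lift₁ w) ∈ D.chartA.source := by
  rw [D.mem_chartA_source_iff]
  refine ⟨D.h₀_lift₁_mem_sliceChart_source hw, ?_⟩
  rw [D.sliceChart_apply_of_mem (D.h₀_lift₁_mem_sliceChart_source hw), D.ψ₂_h₀_lift₁ hw]
  exact hw'

/-- **`h₀ ∘ lift₁` in the chart `κ_A` is the slice inclusion**: `κ_A (h₀ (lift₁ w)) = (0, w)`. [cite: MilnorHCobordism1965, proof of Thm. 5.4, Assertion 6 (PDF pp. 31–32)] -/
theorem chartA_h₀_lift₁ (hw : w ∈ D.domΛ) (hw' : D.Λc w ∈ D.domA) :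
    D.chartA (D.h₀ (D.lift₁ w)) = (0, w) := by
  rw [D.chartA_apply_of_mem (D.h₀_lift₁_mem_chartA_source hw hw'), D.f_h₀_lift₁ hw, sub_self,
    D.ψ₂_h₀_lift₁ hw]
  exact Prod.ext rfl (D.Λcinv_Λc hw)

/-- **`κ_B⁻¹(0, w) = h (lift₁ w)`.** [cite: MilnorHCobordism1965, proof of Thm. 5.4, Assertion 6 (PDF pp. 31–32)] -/
theorem chartB_symm_zero (hw : w ∈ D.domH) (hmem : D.h (D.lift₁ w) ∈ D.chartB.source) :
    D.chartB.symm (0, w) = D.h (D.lift₁ w) := by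
  rw [← D.chartB_h_lift₁ hw hmem, D.chartB.left_inv hmem]

/-- `(0, w)` lies in the target of `κ_B`. [folklore] -/
theorem zero_mem_chartB_target (hw : w ∈ D.domH) (hmem : D.h (D.lift₁ w) ∈ D.chartB.source) :
    ((0 : ℝ), w) ∈ D.chartB.target := by
  rw [← D.chartB_h_lift₁ hw hmem]
  exact D.chartB.map_source hmem

/-- **`κ_A⁻¹(0, Φ w) = h (lift₁ w)`.** [cite: MilnorHCobordism1965, proof of Thm. 5.4, Assertion 6 (PDF pp. 31–32)] -/
theorem chartA_symm_zero_Φ (hw : w ∈ D.dom₁) (hmem : D.h (D.lift₁ w) ∈ D.chartA.source) :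
    D.chartA.symm (0, D.Φ w) = D.h (D.lift₁ w) := by
  rw [← D.chartA_h_lift₁ hw hmem, D.chartA.left_inv hmem]

/-- `(0, Φ w)` lies in the target of `κ_A`. [folklore] -/
theorem zero_Φ_mem_chartA_target (hw : w ∈ D.dom₁) (hmem : D.h (D.lift₁ w) ∈ D.chartA.source) :
    ((0 : ℝ), D.Φ w) ∈ D.chartA.target := by
  rw [← D.chartA_h_lift₁ hw hmem]
  exact D.chartA.map_source hmem

/-- **`κ_A⁻¹(0, w) = h₀ (lift₁ w)`.** [cite: MilnorHCobordism1965, proof of Thm. 5.4, Assertion 6 (PDF pp. 31–32)] -/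
theorem chartA_symm_zero (hw : w ∈ D.domΛ) (hw' : D.Λc w ∈ D.domA) :
    D.chartA.symm (0, w) = D.h₀ (D.lift₁ w) := by
  rw [← D.chartA_h₀_lift₁ hw hw', D.chartA.left_inv (D.h₀_lift₁_mem_chartA_source hw hw')]

/-- `(0, w)` lies in the target of `κ_A`. [folklore] -/
theorem zero_mem_chartA_target (hw : w ∈ D.domΛ) (hw' : D.Λc w ∈ D.domA) :
    ((0 : ℝ), w) ∈ D.chartA.target := by
  rw [← D.chartA_h₀_lift₁ hw hw']
  exact D.chartA.map_source (D.h₀_lift₁_mem_chartA_source hw hw')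

/-- `h ∘ lift₁` is continuous at `0`, with value `p₂`. [folklore] -/
theorem continuousAt_h_lift₁ : ContinuousAt (fun w : 𝔼 (n - k) × 𝔼 k => D.h (D.lift₁ w)) 0 :=
  (D.contMDiffAt_h (D.f_lift₁_mem D.zero_mem_dom₁)).continuousAt.comp
    (D.contMDiffAt_lift₁ D.zero_mem_dom₁).continuousAt

/-- `h (lift₁ 0) = p₂`. [folklore] -/
theorem h_lift₁_zero : D.h (D.lift₁ 0) = D.p₂ := by
  rw [D.lift₁_zero, D.h_p₁]

/-- `h (lift₁ w) → p₂` as `w → 0`. [folklore] -/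
theorem tendsto_h_lift₁ : Tendsto (fun w : 𝔼 (n - k) × 𝔼 k => D.h (D.lift₁ w)) (𝓝 0) (𝓝 D.p₂) := by
  have := D.continuousAt_h_lift₁.tendsto
  rwa [D.h_lift₁_zero] at this

/-- `h₀ (lift₁ 0) = p₂`. [folklore] -/
theorem h₀_lift₁_zero : D.h₀ (D.lift₁ 0) = D.p₂ := by
  have h1 : D.G₂ (D.h₀ (D.lift₁ 0)) = D.G₂ D.p₂ := by
    rw [D.G₂_h₀_lift₁ D.zero_mem_domΛ, D.S₁_symm_zero, D.Λ_t₁, D.G₂_p₂]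
  exact D.G₂.injOn (D.h₀_lift₁_mem D.zero_mem_domΛ) D.p₂_mem h1

/-- `h₀ (lift₁ w) → p₂` as `w → 0`. [folklore] -/
theorem tendsto_h₀_lift₁ : Tendsto (fun w : 𝔼 (n - k) × 𝔼 k => D.h₀ (D.lift₁ w)) (𝓝 0) (𝓝 D.p₂) := by
  -- `h₀ (lift₁ w) = G₂⁻¹ (Λ (S₁⁻¹ (0, w)))` on `domΛ`, a composite of maps continuous at `0`
  have hev : (fun w : 𝔼 (n - k) × 𝔼 k => D.h₀ (D.lift₁ w)) =ᶠ[𝓝 0]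
      fun w => D.G₂.symm (D.Λ (D.S₁.symm (0, w))) := by
    filter_upwards [D.isOpen_domΛ.mem_nhds D.zero_mem_domΛ] with w hw
    show D.G₂.symm (D.Λ (D.G₁ (D.lift₁ w))) = D.G₂.symm (D.Λ (D.S₁.symm (0, w)))
    rw [D.G₁_lift₁ hw.1]
  rw [tendsto_congr' hev]
  have h1 : Tendsto (fun w : 𝔼 (n - k) × 𝔼 k => D.S₁.symm (0, w)) (𝓝 0)
      (𝓝 (D.t₁ • EuclideanSpace.single (0 : Fin (n + 1)) (1 : ℝ))) := by
    have := (D.continuousOn_symm₁.continuousAt (D.isOpen_dom₁.mem_nhds D.zero_mem_dom₁)).tendsto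
    rwa [D.S₁_symm_zero] at this
  have h2 : Tendsto D.Λ (𝓝 (D.t₁ • EuclideanSpace.single (0 : Fin (n + 1)) (1 : ℝ)))
      (𝓝 (D.t₂ • EuclideanSpace.single (0 : Fin (n + 1)) (1 : ℝ))) := by
    have := (D.contDiffAt_Λ D.hitsUp_t₁).continuousAt.tendsto
    rwa [D.Λ_t₁] at this
  have h3 : Tendsto D.G₂.symm (𝓝 (D.t₂ • EuclideanSpace.single (0 : Fin (n + 1)) (1 : ℝ))) (𝓝 D.p₂) :=
    (D.G₂.continuousAt_symm (by rw [← D.G₂_p₂]; exact D.G₂.map_source D.p₂_mem)).tendsto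
  exact h3.comp (h2.comp h1)

/-- **For `w` near `0`, `h (lift₁ w)` lies in the sources of both box charts and `w` in all the
coordinate domains.** [folklore] -/
theorem eventually_mem_sources :
    ∀ᶠ w in 𝓝 (0 : 𝔼 (n - k) × 𝔼 k), w ∈ D.domΦ ∧ w ∈ D.domH ∧ w ∈ D.dom₁ ∧
      D.h (D.lift₁ w) ∈ D.chartA.source ∧ D.h (D.lift₁ w) ∈ D.chartB.source := by
  filter_upwards [D.domΦ_mem_nhds, D.isOpen_domH.mem_nhds D.zero_mem_domH,
    D.isOpen_dom₁.mem_nhds D.zero_mem_dom₁,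
    D.tendsto_h_lift₁ (D.chartA.open_source.mem_nhds D.p₂_mem_chartA_source),
    D.tendsto_h_lift₁ (D.chartB.open_source.mem_nhds D.p₂_mem_chartB_source)] with w h1 h2 h3 h4 h5
  exact ⟨h1, h2, h3, h4, h5⟩

/-- **For `w` near `0`, `h₀ (lift₁ w)` lies in the source of `κ_A` with `κ_A (h₀ (lift₁ w)) = (0, w)`.** [folklore] -/
theorem eventually_mem_domΛ_domA :
    ∀ᶠ w in 𝓝 (0 : 𝔼 (n - k) × 𝔼 k), w ∈ D.domΛ ∧ D.Λc w ∈ D.domA := by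
  have hc : ContinuousAt D.Λc 0 := (D.contDiffAt_Λc D.zero_mem_domΛ).continuousAt
  have h2 : ∀ᶠ w in 𝓝 (0 : 𝔼 (n - k) × 𝔼 k), D.Λc w ∈ D.domA := by
    apply hc.preimage_mem_nhds
    rw [D.Λc_zero]
    exact D.isOpen_domA.mem_nhds D.zero_mem_domA
  filter_upwards [D.isOpen_domΛ.mem_nhds D.zero_mem_domΛ, h2] with w h1 h2
  exact ⟨h1, h2⟩

end Formulas

end CancellationFrame

end Cobordism

end Literature.Topology.FourManifolds
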